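import Summits.QuantumFields.YangMills.Theorems.IsotropyFromPowerCountingTemperedCurvatureMomentsThreePointChartBoundsProductRP

/-!
# Three-point chart bounds IX: the pair Gram property and its transport

Support file for stub `stub_threePointChartBounds` (B) of reshape 4 of
`Cruxes/TemperedCurvatureMoments/Lines/Sketch.lean` (crux stmt-QuantumFields-17721, line `Sketch`).
The pair Gram property (positive semidefinite `2 × 2` Gram form of a disjoint pair below the mirror and a
one-point function above it) follows from product-tensor reflection positivity and is transported along
symmetries on `⁰𝒮` (the four tensors involved lie in `⁰𝒮`).
References: Osterwalder–Schrader, Comm. Math. Phys. 31 (1973) §4.1, 42 (1975) §4; Glimm–Jaffe, Quantum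
Physics (1987) Thm. 6.1.3, §19.5. [folklore]
-/

noncomputable section

open scoped InnerProductSpace ComplexConjugate
open MeasureTheory Filter Set Complex
open _root_.Topology
open Literature.MathematicalPhysics.AQFT Literature.MathematicalPhysics.QuantumLattice
open Literature.MathematicalPhysics.QuantumFieldTheory
open scoped SchwartzMap LineDeriv
open Literature.MathematicalPhysics.QuantumLattice.SchwingerFamily (timeVec)
open Summit.QuantumFields.YangMills.Theorems.CurvatureKernel
open Summit.QuantumFields.YangMills.Cruxes.PlanarSpectralCone.TwoMirrorLightconeSlots.DiscSections (translateMulti_time_space)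

namespace Summit.QuantumFields.YangMills.Theorems.TemperedCurvatureMoments.Sketch.ThreePointChartBounds

/-! ## Part 2: the disjoint-pair bound from the `2 × 2` Gram form -/

section PartTwoCore

/-- Product reflection positivity implies the pair Gram property. [folklore] -/
theorem pairPSD_of_productRP (S₀ : SchwingerFamily (EuclideanSpace ℝ (Fin 4))) (hP : (∀ (N : ℕ) (deg : Fin N → ℕ) (g : (j : Fin N) → Fin (deg j) → 𝓢(EuclideanSpace ℝ (Fin 4), ℂ))
    (F : (j : Fin N) → 𝓢((Fin (deg j) → EuclideanSpace ℝ (Fin 4)), ℂ)),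
    (∀ j, IsTensorOf (F j) (g j)) →
    (∀ j i, HasCompactSupport (g j i : EuclideanSpace ℝ (Fin 4) → ℂ) ∧
      tsupport (g j i : EuclideanSpace ℝ (Fin 4) → ℂ) ⊆ {x : EuclideanSpace ℝ (Fin 4) | 0 < x 0}) →
    (∀ j i i', i ≠ i' → Disjoint (tsupport (g j i : EuclideanSpace ℝ (Fin 4) → ℂ))
      (tsupport (g j i' : EuclideanSpace ℝ (Fin 4) → ℂ))) →
    ∀ H : (i j : Fin N) → 𝓢((Fin (deg i + deg j) → EuclideanSpace ℝ (Fin 4)), ℂ),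
      (∀ i j, IsAppendTensorOf (H i j) (osAdjoint (F i)) (F j)) →
        0 ≤ (∑ i, ∑ j, S₀ (deg i + deg j) (H i j)).re ∧ (∑ i, ∑ j, S₀ (deg i + deg j) (H i j)).im = 0)) : (∀ (f₁ f₂ q : 𝓢(EuclideanSpace ℝ (Fin 4), ℂ)), HasCompactSupport (f₁ : EuclideanSpace ℝ (Fin 4) → ℂ) →
    HasCompactSupport (f₂ : EuclideanSpace ℝ (Fin 4) → ℂ) → HasCompactSupport (q : EuclideanSpace ℝ (Fin 4) → ℂ) →
    tsupport (f₁ : EuclideanSpace ℝ (Fin 4) → ℂ) ⊆ {y | y 0 < 0} →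
    tsupport (f₂ : EuclideanSpace ℝ (Fin 4) → ℂ) ⊆ {y | y 0 < 0} →
    tsupport (q : EuclideanSpace ℝ (Fin 4) → ℂ) ⊆ {y | 0 < y 0} →
    Disjoint (tsupport (f₁ : EuclideanSpace ℝ (Fin 4) → ℂ)) (tsupport (f₂ : EuclideanSpace ℝ (Fin 4) → ℂ)) →
    ∀ lam mu : ℂ,
    0 ≤ (conj lam * lam * S₀ 4 (SchwartzMap.tensorFin 4 ![f₁, f₂, starTest (thetaTest 4 f₂), starTest (thetaTest 4 f₁)]) +
        conj lam * mu * S₀ 3 (SchwartzMap.tensorFin 3 ![f₁, f₂, q]) +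
        conj mu * lam * S₀ 3 (SchwartzMap.tensorFin 3 ![starTest (thetaTest 4 q), starTest (thetaTest 4 f₂),
          starTest (thetaTest 4 f₁)]) +
        conj mu * mu * S₀ 2 (SchwartzMap.tensorFin 2 ![starTest (thetaTest 4 q), q])).re ∧
      (conj lam * lam * S₀ 4 (SchwartzMap.tensorFin 4 ![f₁, f₂, starTest (thetaTest 4 f₂), starTest (thetaTest 4 f₁)]) +
        conj lam * mu * S₀ 3 (SchwartzMap.tensorFin 3 ![f₁, f₂, q]) +
        conj mu * lam * S₀ 3 (SchwartzMap.tensorFin 3 ![starTest (thetaTest 4 q), starTest (thetaTest 4 f₂),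
          starTest (thetaTest 4 f₁)]) +
        conj mu * mu * S₀ 2 (SchwartzMap.tensorFin 2 ![starTest (thetaTest 4 q), q])).im = 0) :=
  fun _ _ _ hf₁c hf₂c hqc hf₁ hf₂ hq hdis lam mu => psd_of_productRP S₀ hP hf₁c hf₂c hqc hf₁ hf₂ hq hdis lam mu

/-- A tensor with pairwise disjoint factor supports lies in `⁰𝒮`. [folklore] -/
theorem isOffDiagonal_tensorFin_of_pairwise {n : ℕ} (v : Fin n → 𝓢(EuclideanSpace ℝ (Fin 4), ℂ))
    (hv : ∀ i j, i ≠ j → Disjoint (tsupport (v i : EuclideanSpace ℝ (Fin 4) → ℂ)) (tsupport (v j : EuclideanSpace ℝ (Fin 4) → ℂ))) :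
    IsOffDiagonal (SchwartzMap.tensorFin n v) := by
  refine IsOffDiagonal.of_tsupport_subset fun x hx hxc => ?_
  obtain ⟨i, j, hij, hxij⟩ := hxc
  have hm := apply_mem_tsupport_of_mem_tsupport_tensorFin _ hx
  exact Set.disjoint_left.1 (hv i j hij) (hm i) (by rw [hxij]; exact hm j)

/-- Transport of the pair Gram property along a symmetry on `⁰𝒮` (the four tensors involved lie in `⁰𝒮`). [folklore] -/
theorem pairPSD_of_forall_isOffDiagonal_eq {S S' : SchwingerFamily (EuclideanSpace ℝ (Fin 4))}
    (h : ∀ (n : ℕ) (F : 𝓢((Fin n → EuclideanSpace ℝ (Fin 4)), ℂ)), IsOffDiagonal F → S' n F = S n F)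
    (hS : (∀ (f₁ f₂ q : 𝓢(EuclideanSpace ℝ (Fin 4), ℂ)), HasCompactSupport (f₁ : EuclideanSpace ℝ (Fin 4) → ℂ) →
    HasCompactSupport (f₂ : EuclideanSpace ℝ (Fin 4) → ℂ) → HasCompactSupport (q : EuclideanSpace ℝ (Fin 4) → ℂ) →
    tsupport (f₁ : EuclideanSpace ℝ (Fin 4) → ℂ) ⊆ {y | y 0 < 0} →
    tsupport (f₂ : EuclideanSpace ℝ (Fin 4) → ℂ) ⊆ {y | y 0 < 0} →
    tsupport (q : EuclideanSpace ℝ (Fin 4) → ℂ) ⊆ {y | 0 < y 0} →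
    Disjoint (tsupport (f₁ : EuclideanSpace ℝ (Fin 4) → ℂ)) (tsupport (f₂ : EuclideanSpace ℝ (Fin 4) → ℂ)) →
    ∀ lam mu : ℂ,
    0 ≤ (conj lam * lam * S 4 (SchwartzMap.tensorFin 4 ![f₁, f₂, starTest (thetaTest 4 f₂), starTest (thetaTest 4 f₁)]) +
        conj lam * mu * S 3 (SchwartzMap.tensorFin 3 ![f₁, f₂, q]) +
        conj mu * lam * S 3 (SchwartzMap.tensorFin 3 ![starTest (thetaTest 4 q), starTest (thetaTest 4 f₂),
          starTest (thetaTest 4 f₁)]) +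
        conj mu * mu * S 2 (SchwartzMap.tensorFin 2 ![starTest (thetaTest 4 q), q])).re ∧
      (conj lam * lam * S 4 (SchwartzMap.tensorFin 4 ![f₁, f₂, starTest (thetaTest 4 f₂), starTest (thetaTest 4 f₁)]) +
        conj lam * mu * S 3 (SchwartzMap.tensorFin 3 ![f₁, f₂, q]) +
        conj mu * lam * S 3 (SchwartzMap.tensorFin 3 ![starTest (thetaTest 4 q), starTest (thetaTest 4 f₂),
          starTest (thetaTest 4 f₁)]) +
        conj mu * mu * S 2 (SchwartzMap.tensorFin 2 ![starTest (thetaTest 4 q), q])).im = 0)) : (∀ (f₁ f₂ q : 𝓢(EuclideanSpace ℝ (Fin 4), ℂ)), HasCompactSupport (f₁ : EuclideanSpace ℝ (Fin 4) → ℂ) →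
    HasCompactSupport (f₂ : EuclideanSpace ℝ (Fin 4) → ℂ) → HasCompactSupport (q : EuclideanSpace ℝ (Fin 4) → ℂ) →
    tsupport (f₁ : EuclideanSpace ℝ (Fin 4) → ℂ) ⊆ {y | y 0 < 0} →
    tsupport (f₂ : EuclideanSpace ℝ (Fin 4) → ℂ) ⊆ {y | y 0 < 0} →
    tsupport (q : EuclideanSpace ℝ (Fin 4) → ℂ) ⊆ {y | 0 < y 0} →
    Disjoint (tsupport (f₁ : EuclideanSpace ℝ (Fin 4) → ℂ)) (tsupport (f₂ : EuclideanSpace ℝ (Fin 4) → ℂ)) →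
    ∀ lam mu : ℂ,
    0 ≤ (conj lam * lam * S' 4 (SchwartzMap.tensorFin 4 ![f₁, f₂, starTest (thetaTest 4 f₂), starTest (thetaTest 4 f₁)]) +
        conj lam * mu * S' 3 (SchwartzMap.tensorFin 3 ![f₁, f₂, q]) +
        conj mu * lam * S' 3 (SchwartzMap.tensorFin 3 ![starTest (thetaTest 4 q), starTest (thetaTest 4 f₂),
          starTest (thetaTest 4 f₁)]) +
        conj mu * mu * S' 2 (SchwartzMap.tensorFin 2 ![starTest (thetaTest 4 q), q])).re ∧
      (conj lam * lam * S' 4 (SchwartzMap.tensorFin 4 ![f₁, f₂, starTest (thetaTest 4 f₂), starTest (thetaTest 4 f₁)]) +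
        conj lam * mu * S' 3 (SchwartzMap.tensorFin 3 ![f₁, f₂, q]) +
        conj mu * lam * S' 3 (SchwartzMap.tensorFin 3 ![starTest (thetaTest 4 q), starTest (thetaTest 4 f₂),
          starTest (thetaTest 4 f₁)]) +
        conj mu * mu * S' 2 (SchwartzMap.tensorFin 2 ![starTest (thetaTest 4 q), q])).im = 0) := by
  intro f₁ f₂ q hf₁c hf₂c hqc hf₁ hf₂ hq hdis lam mu
  have hφ₁s := tsupport_starTest_thetaTest_subset_pos hf₁
  have hφ₂s := tsupport_starTest_thetaTest_subset_pos hf₂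
  have hus : tsupport ((starTest (thetaTest 4 q) : 𝓢(EuclideanSpace ℝ (Fin 4), ℂ)) :
      EuclideanSpace ℝ (Fin 4) → ℂ) ⊆ {y | y 0 < -0} := tsupport_starTest_thetaTest_subset_neg hq
  have hφdis : Disjoint (tsupport ((starTest (thetaTest 4 f₂) : 𝓢(EuclideanSpace ℝ (Fin 4), ℂ)) :
      EuclideanSpace ℝ (Fin 4) → ℂ)) (tsupport ((starTest (thetaTest 4 f₁) : 𝓢(EuclideanSpace ℝ (Fin 4), ℂ)) :
      EuclideanSpace ℝ (Fin 4) → ℂ)) :=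
    Set.disjoint_left.2 fun y hy2 hy1 =>
      Set.disjoint_left.1 hdis (timeReflection_mem_tsupport_of_mem_tsupport_starTest_thetaTest f₁ hy1)
        (timeReflection_mem_tsupport_of_mem_tsupport_starTest_thetaTest f₂ hy2)
  -- sign separation
  have sep : ∀ {a b : 𝓢(EuclideanSpace ℝ (Fin 4), ℂ)}, tsupport (a : EuclideanSpace ℝ (Fin 4) → ℂ) ⊆ {y | y 0 < 0} →
      tsupport (b : EuclideanSpace ℝ (Fin 4) → ℂ) ⊆ {y | 0 < y 0} →
      Disjoint (tsupport (a : EuclideanSpace ℝ (Fin 4) → ℂ)) (tsupport (b : EuclideanSpace ℝ (Fin 4) → ℂ)) :=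
    fun ha hb => Set.disjoint_left.2 fun y hya hyb => by
      have := ha hya; have := hb hyb; simp only [mem_setOf_eq] at *; linarith
  have hus' : tsupport ((starTest (thetaTest 4 q) : 𝓢(EuclideanSpace ℝ (Fin 4), ℂ)) :
      EuclideanSpace ℝ (Fin 4) → ℂ) ⊆ {y | y 0 < 0} := fun y hy => by
    have := hus hy; simp only [mem_setOf_eq, neg_zero] at this ⊢; exact this
  have h4 : IsOffDiagonal (SchwartzMap.tensorFin 4 ![f₁, f₂, starTest (thetaTest 4 f₂), starTest (thetaTest 4 f₁)]) := by
    refine isOffDiagonal_tensorFin_of_pairwise _ fun i j hij => ?_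
    fin_cases i <;> fin_cases j
    · exact absurd rfl hij
    · simpa using hdis
    · simpa using sep hf₁ hφ₂s
    · simpa using sep hf₁ hφ₁s
    · simpa using hdis.symm
    · exact absurd rfl hij
    · simpa using sep hf₂ hφ₂s
    · simpa using sep hf₂ hφ₁s
    · simpa using (sep hf₁ hφ₂s).symm
    · simpa using (sep hf₂ hφ₂s).symm
    · exact absurd rfl hij
    · simpa using hφdis
    · simpa using (sep hf₁ hφ₁s).symm
    · simpa using (sep hf₂ hφ₁s).symm
    · simpa using hφdis.symm
    · exact absurd rfl hij
  have h3 : IsOffDiagonal (SchwartzMap.tensorFin 3 ![f₁, f₂, q]) :=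
    isOffDiagonal_tensorFin_three hdis (sep hf₁ hq) (sep hf₂ hq)
  have h3' : IsOffDiagonal (SchwartzMap.tensorFin 3 ![starTest (thetaTest 4 q), starTest (thetaTest 4 f₂),
      starTest (thetaTest 4 f₁)]) :=
    isOffDiagonal_tensorFin_three (sep hus' hφ₂s) (sep hus' hφ₁s) hφdis
  have h2 : IsOffDiagonal (SchwartzMap.tensorFin 2 ![starTest (thetaTest 4 q), q]) :=
    isOffDiagonal_tensorFin_two_of_disjoint (sep hus' hq)
  rw [h 4 _ h4, h 3 _ h3, h 3 _ h3', h 2 _ h2]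
  exact hS f₁ f₂ q hf₁c hf₂c hqc hf₁ hf₂ hq hdis lam mu

end PartTwoCore

end Summit.QuantumFields.YangMills.Theorems.TemperedCurvatureMoments.Sketch.ThreePointChartBounds

end
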